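import Summits.BirchSwinnertonDyer.BirchSwinnertonDyer.Theorems.AlignedTransportAtTwoMainConjectureTransportAlignedAtTwoKilfordKernelLetterCapstoneAdditive
import Summits.BirchSwinnertonDyer.BirchSwinnertonDyer.Theorems.AlignedTransportAtTwoMainConjectureTransportAlignedAtTwoKilfordKernelLetterTorsion
import Summits.BirchSwinnertonDyer.Rank1Residual.F1Sign2.AnalyticLineTransferAtTwo
import Literature.NumberTheory.EllipticCurves.ModularJacobianTwoTorsionSymmetricPairing
import Literature.NumberTheory.EllipticCurves.ModularJacobianGaloisDataWithForms
import HarnessLib.Audit.Tags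
import HarnessLib

/-!
# Cell `bsd-f1-sign2` — typer file for crux C1 `MainConjectureTransportAlignedAtTwo` (stmt-BirchSwinnertonDyer-22296), residual (R2)
# `stub_lamLawKilford` at EQUAL conductors: the KERNEL-LETTER CARRIER `KernelLetterCarrierAtTwo` — (W1) the multiplicative part of `J₀(N)[2]`
# with its socle set, (W0′) functoriality of the connected part, over the tree's (W3) carrier `ModularJacobianGaloisDataWithPairing`

STATEMENT ONLY (one `@[conjecture] def … : Prop` over tree declarations; nothing asserted, no `sorry`, no instance, no `Module (ZMod 2)`, no
`Representation`; BSD is not proved by this, C1 is not closed by this).  TYPING ASK of width seat att-p4 g17 (INBOX 2026-08-29T04:45:44Z, «turnkey: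
ONE statement-only Prop over the tree's `ModularJacobianGaloisData` … Body = the (W3)/(W1)/(W0′) binders of
`…KilfordKernelLetterCarrier.lamLawKilford_of_conductorNorm_eq_of_carrier` VERBATIM on `A := ↥(Submodule.torsionBy (HeckeRing0 N 2) (J0 N) 2)`,
`U := ((torsionBySet 𝕋 (J0 N) 𝔪_f).comap A.subtype).toAddSubgroup` … (W0′) quantified over all `W`, `D : ModularParametrizationData W N` good
ordinary at `2` on the cell»; memo `Cruxes/MainConjectureTransportAlignedAtTwo/KERNEL-LETTER-att-p4-g17.md` §2 (rows) / §4 (recipe); consumer in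
the tree, kernel-checked: `Summit.BirchSwinnertonDyer.BirchSwinnertonDyer.Theorems.AlignedTransportAtTwoKilfordKernelLetterCarrier.lamLawKilford_of_conductorNorm_eq_of_carrier`,
p696358 ACCEPTED).

DESIGN (typer, -ty g15).  (W3) — the `w_N`-twisted Weil pairing on `J₀(N)[2]` reduced mod `2`: left-separating, symmetric, `galAct`-invariant,
Hecke-self-adjoint — is ALREADY a tree object: the structure `Literature.NumberTheory.EllipticCurves.ModularForms.ModularJacobianGaloisDataWithPairing N ι`
(extends `ModularJacobianGaloisData N ι` by `pairingTwo` with exactly these four laws; typer g14, p691097, REF2 v47 §1 slot read CLEAN: DDT 1995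
Lemma 1.38 / (4.4.2) / Cor 4.19, Milne 1986 §16, ARS 2011), inhabited for every `N`, `ι` by the named fact
`exists_modularJacobianGaloisDataWithPairing_eichlerShimura`.  So the carrier is typed OVER that structure (`J : ModularJacobianGaloisDataWithPairing N ι`,
`B := J.pairingTwo`) instead of re-quantifying `∃ B` over a bare `ModularJacobianGaloisData` (dedup: one (W3) carrier in the tree, not two), and
asserts the two remaining rows with the consumer's binders VERBATIM:
* (W0′) ONE additive subgroup `M ≤ A` («the multiplicative = connected part of `J₀(N)[2]` over `ℤ₂`») such that for EVERY `W` (elliptic, globally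
  minimal, good ORDINARY at `2`), EVERY `D : ModularParametrizationData W N` and EVERY place `v ∣ 2` of `𝓞 ℚ`: a geometric `2`-torsion point `P` of `W`
  with `ι(P) = D.jacobiMap m`, `m ∈ M`, lies in the `2`-adic letter `C₂(W)[2]` (`(reductionDatum W 2 hpv _).plus`, the kernel-of-reduction line of the
  ordinary curve) — functoriality of the connected part of the `2`-torsion of Néron models under the `ℚ`-morphism `J₀(N) → W` [folklore: Néron
  mapping property + «connected ↦ connected»; for `W` ordinary at `2` the connected part of `W[2]/ℤ₂` is `C₂(W)[2]`];
* (W1) for every `W` ON THE CELL'S KILFORD STRATUM (good ordinary at `2`, no rational `2`-torsion, `Δ_W` not a square, `OnKilfordStratumAtTwo W`) and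
  every `D : ModularParametrizationData W N` at which MULT2's conclusion holds (`finrank_{𝕋/𝔪} J₀(N)[𝔪_{D.f}] = 4`, `𝔪 = modTwoHeckeIdeal D.f`), with
  `U := J₀(N)[𝔪] ⊆ A`: `M` is `⊥`-closed inside `U` for `B` (`x ∈ U`, `x ⊥ M ⟹ x ∈ M` — maximal isotropy of the multiplicative part on the ORDINARY
  `𝔪`-component; phrased INSIDE `U` because globally `(J[2]^μ)^⊥ = J[2]⁰ ⊋ J[2]^μ` when `J₀(N)` has non-ordinary factors, memo §2), and there are a set
  `M₀ ⊇ M ∩ U` of EXACTLY `8 = 2^{2r−1}` (`r = 2`) elements and `m₀` with every `x ∈ M₀` of the form `t • m₀`, `t ∈ 𝕋`, `t • A ⊆ U` («`M ∩ J[𝔪] =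
  soc(T̄_𝔪)·m₀`») [cite: Wiese2007Multiplicities, Situation II, Thm. 2.1, Prop. 2.2, Cor. 4.2] [cite: KilfordWiese2008, Thm. 1.3, Cor. 1.6, Question 1.9].
  PLACEMENT (REF2-PLACEMENT-v47 §12, af7b303da4b17b44, slot read of p698035: CLEAN modulo this SHARPENING, folded as text by typer g15 — it also
  corrects the earlier «REF2 v7» sentence): Wiese 2007 Situation II is «`p` ANY prime, `N` a positive integer not divisible by `p`,
  `T_{ℤ→ℤ_p}(S₂(Γ₁(N)))`, `𝔪` ordinary, `ρ_𝔪` irreducible, `J = J₁(N)`» [corpus:paper:doi-10-2140-ant-2007-1-67 p0004 L28–38] — NO prime-level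
  restriction — and there: Thm 2.1 (Gross) [p0005 L5–20], **Prop 2.2 «`G⁰[p](ℚ̄_p) ≅ T_{𝔽_p,𝔪}` as `T_{𝔽_p,𝔪}`-modules»** [p0005 L52–54] (cyclic
  multiplicative part = the «`t • m₀`» row), **Cor 4.2 «`r = ½(dim T_{𝔽_p,𝔪}[𝔪] + 1)`» with «`T_{𝔽_p,𝔪}[𝔪] = G⁰[p](ℚ̄)[𝔪]` has dimension `2r − 1`»**
  [p0012 L20–27, L36–38] ⟹ «`#(M ∩ J[𝔪]) = 2^{2r−1}`» is IN PRINT AT EVERY LEVEL PRIME TO `2` (in the `J₁(N)`/`Γ₁(N)`-algebra setting).  NOT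
  level-generic in print is only the VALUE `r = 2` (the hypothesis `finrank = 4` below): KW 2008 Thm 1.3 [corpus:paper:arxiv-math_0612317 p0004 L1–8:
  `r > 1` under scalar `Frob_p`, with the `p = 2` proviso «a Katz weight-1 form over `𝔽₂` on `Γ₁(N)` giving `ρ_𝔪` exists»], Cor 1.6 `d = 2r − 2`
  [p0004 L80–91], Question 1.9 [p0005 L48ff, PRIME level — open at `p = 2`; ANSWERED «yes» for ODD `p` by [cite: CalegariGeraghty2018, Thm. 3.25, Rem. 3.26, Rem. 3.29], while
  [cite: CalegariGeraghty2018, Rem. 3.31] expects `p = 2` via [cite: Snowden2018SingularitiesOrdinary, §4] only for NON-dihedral `ρ̄` — the `S₃ = D₃` stratum here is dihedral: fold 2026-08-29, att-p3 g21], `r = 2` computed at 431/503/2089 [p0004 L96–104], Wiese p. 68 «always seems to be 2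
  if it is not 1»; KW Prop 2.1 [p0006 L22–33] is the multiplicity-ONE ⟹ `T̄ ⊕ T̄` direction (contrast only).  So the gap (γ) making this `Prop`
  conjecture-grade (`@[conjecture]`, not a named fact) is exactly: (i) the `J₁(N)`/`Γ₁(N)`-algebra → `J₀(N)`/`𝕋` transfer at an ordinary
  non-Eisenstein `𝔪` above `2`, and (ii) `r = 2` off the computed levels — not «no multiplicity theorem off prime level».  `⊥`-closedness of `M`
  inside `U` = print-assembly from the Cartier self-duality swapping `G⁰`/`Gᵉ` (Wiese Thm 2.1 (b),(c) = Gross 1990 Props 12.8/12.9 + p. 485 twist; at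
  `p = 2` it must come from this duality since `μ₂ ≅ ℤ/2`) — covered by [cite: Gross1990, p. 485, Props. 12.8–12.9] and the DDT cites below.
The quantifier order `∃ M, (∀ W D v …) ∧ (∀ W … D …)` is what a PAIR consumer needs: at equal conductor `N(W₁) = N(W₂) = N` the consumer feeds ONE `B`,
ONE `M` (rows (W0′) for both `(W₁, D₁)` and `(W₂, D₂)`) and the socle data of `U = J₀(N)[𝔪_{f₁}]` (row (W1) at `(W₁, D₁)`); the kernel glue
`lamLawKilford_of_conductorNorm_eq_of_kernelLetterCarrierAtTwo` doing exactly that `obtain` is filed in the sibling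
`F1Sign2/KernelLetterCarrierAtTwoKernel.lean` (imports the consumer; this file does not, so the consumer's lineage may import THIS file: skeleton v28's
`stub_kernelLetterCarrierAtTwo : ∀ N ι (J : ModularJacobianGaloisDataWithPairing N ι), KernelLetterCarrierAtTwo N ι J`, memo §4 item 2, with T1+(W3)
supplied together by `exists_modularJacobianGaloisDataWithPairing_eichlerShimura`).
CENSUS (BC5 witness, from the asking seats): H12/P14/PLANES 74/74 (att-p5 g17) + att-p5 g18 cross-level 43/43 («aligned ⟹ D(C₁) = C₂» 12/12,
«misaligned ⟹ planes meet in 0» 31/31, `dim J₀(N₂)[𝔪₂] = 4` 17/17); soundness of the `⊥`-closed row on the ordinary `𝔪`-component checked on paper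
(memo §2); non-vacuity of the abstract rows = REF1 §161 toy model (θ = coordinate projections).  Cheapest falsifier: a Kilford-stratum pair at prime
level with `#(M ∩ J₀(N)[𝔪]) ≠ 8` or a non-isotropic multiplicative part on an ordinary `𝔪`-component — none in the 74 + 43 rows.  Why novel (att-p4):
a second, copy-free kernel route to «aligned at 2 ⟹ same half-class kernel» at equal conductors, whose only non-print inputs are MULT2 (KW Question 1.9)
and these carrier rows.  REF1: not yet audited as a file (REF1 g15 FINAL 04:52Z; §161 covers (W3)'s symmetric clause).  REF2 v47 §12 (05:18Z): slot read of
p698035 CLEAN modulo the placement sharpening above (keys 4/4 resolve; `@[conjecture]` correct; (W3)-over-structure dedup = v47 §1 CLEAN); kernel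
glue `KernelLetterCarrier.lamLawKilford_of_conductorNorm_eq_of_kernelLetterCarrierAtTwo` filed as `F1Sign2/KernelLetterCarrierAtTwoKernel.lean` (p698739).
REF1-AUDIT §177 (c) (-ref1 g16, 2026-08-29T05:52Z, `HOME/REF1-AUDIT-v1.md` 8e0ecf498efd3e50; folded as text by -ty g15): FILE AUDIT of p698035 — **SURVIVES,
conjecture-grade carrier axiom; the only conjecture-grade content is the socle row (γ)** (count `2^{2r−1}` + cyclicity, `J₁ → J₀`, `r = 2`); (W0′) and
`⊥`-closedness are THEOREM-grade for the NATURAL MODEL `M = J₀(N)[2]⁰` (the connected part = kernel of reduction at the 2-adic place fixed by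
`reductionDatum`'s embedding), which is `⊥`-closed even GLOBALLY by Cartier duality of `0 → J[2]⁰ → J[2] → J[2]^{ét} → 0` (`(J[2]⁰)^⊥ = J[2]^μ ⊆ J[2]⁰`);
the inside-`U` phrasing covers the other candidate `M = J[2]^μ` too; JUNK MODELS: `M = ⊥` satisfies (W0′) but is killed by `⊥`-closedness as soon as
the (W1)-frame is inhabited, `M = ⊤` is killed by the socle clause (`#U = 16 > 8`); at levels with EMPTY (W1)-frame the `Prop` is TRIVIALLY inhabited by
`M = ⊥` — harmless for the consumer (it instantiates (W1) at `(W₁, D₁, h4)`), but a skeleton stub `∀ N ι J, …` must not be read as «verified at all N»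
from easy levels; p698739 glue CLEAN.
APPEND (-ty g15, 2026-08-29T07:5xZ) — TYPING ASK 2 of width seat att-p4 g18 (INBOX «TWO TYPING ASKS for the UNEQUAL-conductor branch», memo
`Cruxes/MainConjectureTransportAlignedAtTwo/CARRIER-PROP-att-p4-g18.md` §4 item 2, verbatim clause): the second `Prop` below,
**`KernelLetterCarrierWithFormsAtTwo N ι J`** = `KernelLetterCarrierAtTwo N ι J` with (W1) VERBATIM and the (W0′) clause WIDENED from `D.jacobiMap`
(`D : ModularParametrizationData W N`, the newform of `W` at level `N`) to `D.jacobiMapForm N g hg` for EVERY `W` good ordinary at `2`, EVERY level `N₁`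
and datum `D : ModularParametrizationData W N₁`, and EVERY `g ∈ S₂(Γ₀(N))` with RATIONAL `q`-expansion and `c·Λ_N(g) ⊆ Λ_W`
(`Literature/NumberTheory/EllipticCurves/ModularJacobianGaloisDataWithForms.lean`, now imported): the same Néron functoriality («connected ↦ connected»
under the `ℚ`-morphism `φ_g : J₀(N) → W`, whose rationality is the `q`-expansion principle [cite: DarmonDiamondTaylor1995, §1.5 (p. 38), §1.7 Def. 1.44
and Lemma 1.46 (p. 44–45)]), needed by att-p4 g18's cross-level capstone `…KilfordKernelLetterCrossLevelCarrier.uniformize_oldLine_ker_iff_of_carrier`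
for the OLD-LINE map `D₁.jacobiMapForm N₂ F₁ hg` (no newform of `W₁` at level `N₂`, so the old clause cannot serve).  The old clause is the case
`N₁ = N`, `g = D.f` (`ModularParametrizationData.jacobiMapForm_self`; `D.f` has rational — indeed integral — `q`-expansion by `IsNewformOf`):
kernel glue `KernelLetterCarrier.kernelLetterCarrierAtTwo_of_withForms : KernelLetterCarrierWithFormsAtTwo N ι J → KernelLetterCarrierAtTwo N ι J` in
`F1Sign2/KernelLetterCarrierAtTwoKernel.lean`.  The joint carrier for T2(J) + `pairingTwo_galAct` on ONE `galAct` (att-p4's ASK 1) is the typer's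
Literature filing `ModularJacobianGaloisDataWithFormsAndPairing.lean` (p701751): feed `J := Dj.toModularJacobianGaloisDataWithPairing` for
`Dj : ModularJacobianGaloisDataWithFormsAndPairing N ι`.  Grade: conjecture-grade exactly as `KernelLetterCarrierAtTwo` (same socle row (γ); the widened
(W0′) is theorem-grade folklore for `M = J₀(N)[2]⁰`, REF1 §177 (c)); REF1 audit of the widened clause: pending (ask filed with this landing).
APPEND 2 (-ty g15, 2026-08-29T08:0xZ) — the LEVEL-`L` CARRIER asked by att-p3 g18 (SESSION END 06:24:47Z «WHAT REMAINS for (R2) unequal conductors: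
(i) the level-L carrier Prop (-ty; θᵢ = `Dᵢ.jacobiMapForm L Fᵢ`, 𝔪 ⊇ span{2, T_p−a_p, T_q−1})», memo `CROSS-LEVEL-att-p3-g18.md` §11–§12: «to be typed by
-ty as the level-`L` analogue of `F1Sign2.KernelLetterCarrierAtTwo` (p698035), whose `D.jacobiMap`/`modTwoHeckeIdeal D.f` must become `D.jacobiMapForm L F_Q` /
the mod-2 eigen-ideal of `F_Q`»; = att-p4 g18's «THIRD GAP», an eigen-ideal at a common level `L` that is the conductor of NEITHER curve): the third `Prop`
below, **`KernelLetterCarrierAtLevelAtTwo L ι J`** — (W0′-forms) exactly as in `KernelLetterCarrierWithFormsAtTwo`, and (W1) at an ABSTRACT maximal ideal: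
for every `W` on the Kilford stratum and EVERY ideal `𝔪 ⊆ 𝕋_ℤ(L)` with `#(𝕋/𝔪) = 2` whose eigen-character is `ρ̄_{W,2}`'s (`T_p − a_p(W) ∈ 𝔪` for every
prime `p ∤ L`, `L` odd — so `𝔪` is ordinary (`a₂(W)` odd) and non-Eisenstein (`W[2]` has image `S₃`; Brauer–Nesbitt), i.e. Wiese's Situation II transferred
to `J₀(L)`), IF `dim_{𝕋/𝔪} J₀(L)[𝔪] = 4` THEN the socle rows of (W1) hold for `U := J₀(L)[𝔪]`.  No newform of `W` at level `L`, no `D`, no `F` is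
mentioned in (W1): the consumer `…KilfordCopyCrossLevelCommonLevelLetter.uniformize_twoOldLines_ker_iff_of_alignedAtTwo` (p699581) takes `U` abstractly
(`Nat.card U = 16`, Galois-stable) and gets «`θ_F` kills `U^⊥ = 𝔪·J₀(L)[2]`» from att-p3's `oldLines_half_smul_mem_of_mem_span` (p702281) /
`jacobiMapForm_oldLines_half_smul_eq_zero` (p702557) once it shows that att-p3's generator ideal `span{2, T_p − a_p(f) (p ∉ Q), T_q − 1 (q ∈ Q)}` has a
two-element quotient (every `T_n` is an integer mod it; proper because `θ_F ≠ 0`).  At `L = N(W)` with `𝔪 = modTwoHeckeIdeal D.f` the hypotheses of the new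
(W1) are the expected ones (`𝕋/𝔪_f ≅ 𝔽₂` modulo `IsNewform0.heckeEigenvalue_eq_coeff`, `T_p − a_p ∈ Ann(f) + (2)` by the eigenform property), so the new
(W1) contains the old one modulo those named facts — no kernel glue filed for that direction (it would import them); grade: conjecture-grade with the SAME
gap (γ) as `KernelLetterCarrierAtTwo` ((i) `J₁(L) → J₀(L)` transfer at an ordinary non-Eisenstein `𝔪 ∣ 2`, (ii) the value `r = 2`, now a HYPOTHESIS at
`(L, 𝔪)`); att-p5 g19's fifth engine (SOCLE memo, 36/36 + 29/29 levels: `T̄_𝔪` faithful, `s = dim soc T̄_𝔪 = 3`, `#soc·J[2]_𝔪 = J[𝔪]`) is the census of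
exactly this row at conductor levels; lcm-shape common levels are NOT RUN (symbol index ≥ 48 384) — recorded as the row's untested cell.  REF1 audit: pending.
PARTITION: none moved; beyond-print theorem: no; BSD not proved; no item closed.
bears_on: `stmt-BirchSwinnertonDyer-22296` (C1, (R2) equal conductors), `stmt-BirchSwinnertonDyer-22298` (C2, via att-p5's cross-level planes).
-/

open scoped NumberField Classical
open Field IsDedekindDomain NumberField WeierstrassCurve
open Literature.NumberTheory.EllipticCurves Literature.NumberTheory.EllipticCurves.ModularForms
open Literature.NumberTheory.EllipticCurves.Greenberg1999
open Summit.BirchSwinnertonDyer.Rank1Residual.X2 Summit.BirchSwinnertonDyer.Rank1Residual.X2.GreenbergVatsalReductionDatum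

noncomputable section

namespace Summit.BirchSwinnertonDyer.Rank1Residual.F1Sign2

/-- **`KernelLetterCarrierAtTwo N ι J` — the kernel-letter carrier rows (W1) + (W0′) on the CONCRETE `A = J₀(N)(ℂ)[2] = ↥(torsionBy 𝕋 (J0 N) 2)`,
over the tree's (W3) carrier `J : ModularJacobianGaloisDataWithPairing N ι` (`B = J.pairingTwo`).**  There is an additive subgroup `M ≤ A` (the
multiplicative/connected part at `2`) such that
(W0′) for every `W/ℚ` (elliptic, globally minimal, good ordinary at `2`), every `D : ModularParametrizationData W N` and every place `v ∣ 2`: if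
`m ∈ M` and `P ∈ W[2](ℚ̄)` with `ι(P) = D.jacobiMap m`, then `P ∈ C₂(W)[2]` (`(reductionDatum W 2 hpv _).plus`) [folklore: Néron functoriality of the
connected part]; and
(W1) for every `W` on the Kilford stratum of the cell (good ordinary at `2`, `∀ x, ¬ HasRationalTwoTorsionX W x`, `¬ IsSquare W.Δ`,
`OnKilfordStratumAtTwo W`) and every `D : ModularParametrizationData W N` with `finrank_{𝕋/𝔪} J₀(N)[𝔪] = 4` (`𝔪 = modTwoHeckeIdeal D.f`; MULT2's
conclusion), writing `U = J₀(N)[𝔪] ⊆ A`: `M` is `⊥`-closed inside `U` for `J.pairingTwo`, and `M ∩ U ⊆ M₀` for a set `M₀` of exactly `8` elements all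
of the form `t • m₀` with `t ∈ 𝕋`, `t • A ⊆ U` [cite: Wiese2007Multiplicities, Situation II, Prop. 2.2 and Cor. 4.2] [cite: KilfordWiese2008,
Thm. 1.3, Cor. 1.6, Question 1.9] — the socle count `2^{2r−1}` is printed at EVERY level prime to `2` (`J₁(N)`-setting); the gap (γ) is the
`J₁ → J₀` transfer and the value `r = 2` (module docstring, REF2 v47 §12).  Binders = those of the consumer
`…KilfordKernelLetterCarrier.lamLawKilford_of_conductorNorm_eq_of_carrier` (p696358) VERBATIM, with `B := J.pairingTwo` (its four (W3) laws are the
structure fields `pairingTwo_left` / `pairingTwo_symm` / `pairingTwo_galAct` / `pairingTwo_smul`).  Conjecture-grade carrier axiom: `@[conjecture]`.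
[cite: Gross1990, p. 485] [cite: DarmonDiamondTaylor1995, §1.7 (Lemma 1.38) and §4.4 (Cor. 4.19)] -/
@[conjecture] def KernelLetterCarrierAtTwo (N : ℕ) [NeZero N] (ι : AlgebraicClosure ℚ →+* ℂ)
    (J : ModularJacobianGaloisDataWithPairing N ι) : Prop :=
  ∃ M : AddSubgroup ↥(Submodule.torsionBy (HeckeRing0 N 2) (J0 N) 2),
    -- (W0′) functoriality of the connected part, for every good-ordinary-at-2 curve parametrised at level `N`
    (∀ (W : WeierstrassCurve ℚ) [W.IsElliptic] [W.IsGloballyMinimal] (hord : IsOrdinaryAt W 2)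
        (D : ModularParametrizationData W N) (v : HeightOneSpectrum (𝓞 ℚ)) (hpv : ((2 : ℕ) : 𝓞 ℚ) ∈ v.asIdeal),
        ∀ m ∈ M, ∀ P : ↥(W.geomTorsion 2), W.geomPointsToComplex ι (P : geomPoints W) = D.jacobiMap (m : J0 N) →
          (AddSubgroup.inclusion (geomTorsion_le_geomPrimaryTorsion W 2) P : ↥(W.geomPrimaryTorsion 2)) ∈
            (reductionDatum W 2 hpv (fun h ↦ W.not_hasGoodReductionAtPrime_of_dvd_minimalDiscriminantInt 2 h hord.1)).plus) ∧
    -- (W1) the multiplicative part inside `U = J₀(N)[𝔪_{D.f}]` on the Kilford stratum: `⊥`-closed, and its socle set of `8` elements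
    (∀ (W : WeierstrassCurve ℚ) [W.IsElliptic] [W.IsGloballyMinimal], IsOrdinaryAt W 2 →
        (∀ x : ℚ, ¬ HasRationalTwoTorsionX W x) → ¬ IsSquare W.Δ → OnKilfordStratumAtTwo W →
        ∀ (D : ModularParametrizationData W N),
          Module.finrank (HeckeRing0 N 2 ⧸ modTwoHeckeIdeal D.f)
            (Submodule.torsionBySet (HeckeRing0 N 2) (J0 N) (modTwoHeckeIdeal D.f)) = 4 →
          (∀ x ∈ ((Submodule.torsionBySet (HeckeRing0 N 2) (J0 N) (modTwoHeckeIdeal D.f : Set (HeckeRing0 N 2))).comap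
              (Submodule.torsionBy (HeckeRing0 N 2) (J0 N) 2).subtype).toAddSubgroup, (∀ m ∈ M, J.pairingTwo m x = 0) → x ∈ M) ∧
          ∃ (M₀ : Set ↥(Submodule.torsionBy (HeckeRing0 N 2) (J0 N) 2)) (m₀ : ↥(Submodule.torsionBy (HeckeRing0 N 2) (J0 N) 2)),
            M₀.ncard = 8 ∧
            (∀ x ∈ M, x ∈ ((Submodule.torsionBySet (HeckeRing0 N 2) (J0 N) (modTwoHeckeIdeal D.f : Set (HeckeRing0 N 2))).comap
                (Submodule.torsionBy (HeckeRing0 N 2) (J0 N) 2).subtype).toAddSubgroup → x ∈ M₀) ∧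
            (∀ x ∈ M₀, ∃ t : HeckeRing0 N 2,
              (∀ a : ↥(Submodule.torsionBy (HeckeRing0 N 2) (J0 N) 2),
                t • a ∈ ((Submodule.torsionBySet (HeckeRing0 N 2) (J0 N) (modTwoHeckeIdeal D.f : Set (HeckeRing0 N 2))).comap
                  (Submodule.torsionBy (HeckeRing0 N 2) (J0 N) 2).subtype).toAddSubgroup) ∧ t • m₀ = x))

/-- **`KernelLetterCarrierWithFormsAtTwo N ι J`** — the kernel-letter carrier with the (W0′) clause WIDENED TO FORMS (typing ask 2 of att-p4 g18,
memo `CARRIER-PROP-att-p4-g18.md` §4; conjecture-grade exactly as `KernelLetterCarrierAtTwo`, whose (W1) clause is repeated VERBATIM): there is ONE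
additive subgroup `M ≤ J₀(N)[2]` («the multiplicative = connected part over `ℤ₂`») such that
* (W0′-forms) for EVERY `W` (elliptic, globally minimal, good ORDINARY at `2`), EVERY level `N₁` and `D : ModularParametrizationData W N₁`, EVERY
  `g ∈ S₂(Γ₀(N))` with RATIONAL `q`-expansion at `∞` and `c·φ(g) ∈ Λ_W` for all `φ ∈ H₁(X₀(N); ℤ)`, and EVERY place `v ∣ 2`: a geometric `2`-torsion
  point `P` of `W` with `ι(P) = D.jacobiMapForm N g hg m`, `m ∈ M`, lies in the `2`-adic letter `C₂(W)[2]` (`(reductionDatum W 2 hpv _).plus`) —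
  functoriality of the connected part of the `2`-torsion of Néron models under the `ℚ`-morphism `φ_g : J₀(N) → W` (rational by the `q`-expansion
  principle; for ordinary `W`, `W[2]⁰ = C₂(W)[2]`) [folklore: Néron mapping property + «connected ↦ connected»]
  [cite: DarmonDiamondTaylor1995, §1.5 (p. 38), §1.7 Def. 1.44 and Lemma 1.46 (p. 44–45)] [cite: ShimuraIATAF1971, Thm. 7.14];
* (W1) VERBATIM as in `KernelLetterCarrierAtTwo` [cite: Wiese2007Multiplicities, Situation II, Thm. 2.1, Prop. 2.2, Cor. 4.2]
  [cite: KilfordWiese2008, Thm. 1.3, Cor. 1.6, Question 1.9] [cite: Gross1990, p. 485, Props. 12.8–12.9].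
The old (W0′) is the case `N₁ = N`, `g = D.f` (`jacobiMapForm_self`): `KernelLetterCarrier.kernelLetterCarrierAtTwo_of_withForms` (Kernel file).
Consumer: att-p4 g18's `uniformize_oldLine_ker_iff_of_carrier` (rows (W1)/(W0′)/(W0′-old) from ONE `J` + this ONE `Prop`; T2(J) from the joint carrier
`ModularJacobianGaloisDataWithFormsAndPairing`).  Why it might fail: only through the socle row (γ) (as `KernelLetterCarrierAtTwo`); the widened (W0′)
is theorem-grade for `M = J₀(N)[2]⁰`.  [cite: DarmonDiamondTaylor1995, §1.7 (Lemma 1.38) and §4.4 (Cor. 4.19)] -/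
@[conjecture] def KernelLetterCarrierWithFormsAtTwo (N : ℕ) [NeZero N] (ι : AlgebraicClosure ℚ →+* ℂ)
    (J : ModularJacobianGaloisDataWithPairing N ι) : Prop :=
  ∃ M : AddSubgroup ↥(Submodule.torsionBy (HeckeRing0 N 2) (J0 N) 2),
    -- (W0′-forms) functoriality of the connected part under every lattice-compatible RATIONAL form's Jacobi map `J₀(N) → W`
    (∀ (W : WeierstrassCurve ℚ) [W.IsElliptic] [W.IsGloballyMinimal] (hord : IsOrdinaryAt W 2)
        (N₁ : ℕ) [NeZero N₁] (D : ModularParametrizationData W N₁) (g : CuspForm (CongruenceSubgroup.Gamma0 N) 2)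
        (_ : ∀ n : ℕ, ∃ q : ℚ, cuspCoeff g n = (q : ℂ))
        (hg : ∀ φ ∈ periodHomology N, (D.c : ℂ) * φ g ∈ D.L.lattice)
        (v : HeightOneSpectrum (𝓞 ℚ)) (hpv : ((2 : ℕ) : 𝓞 ℚ) ∈ v.asIdeal),
        ∀ m ∈ M, ∀ P : ↥(W.geomTorsion 2), W.geomPointsToComplex ι (P : geomPoints W) = D.jacobiMapForm N g hg (m : J0 N) →
          (AddSubgroup.inclusion (geomTorsion_le_geomPrimaryTorsion W 2) P : ↥(W.geomPrimaryTorsion 2)) ∈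
            (reductionDatum W 2 hpv (fun h ↦ W.not_hasGoodReductionAtPrime_of_dvd_minimalDiscriminantInt 2 h hord.1)).plus) ∧
    -- (W1) the multiplicative part inside `U = J₀(N)[𝔪_{D.f}]` on the Kilford stratum: `⊥`-closed, and its socle set of `8` elements
    (∀ (W : WeierstrassCurve ℚ) [W.IsElliptic] [W.IsGloballyMinimal], IsOrdinaryAt W 2 →
        (∀ x : ℚ, ¬ HasRationalTwoTorsionX W x) → ¬ IsSquare W.Δ → OnKilfordStratumAtTwo W →
        ∀ (D : ModularParametrizationData W N),
          Module.finrank (HeckeRing0 N 2 ⧸ modTwoHeckeIdeal D.f)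
            (Submodule.torsionBySet (HeckeRing0 N 2) (J0 N) (modTwoHeckeIdeal D.f)) = 4 →
          (∀ x ∈ ((Submodule.torsionBySet (HeckeRing0 N 2) (J0 N) (modTwoHeckeIdeal D.f : Set (HeckeRing0 N 2))).comap
              (Submodule.torsionBy (HeckeRing0 N 2) (J0 N) 2).subtype).toAddSubgroup, (∀ m ∈ M, J.pairingTwo m x = 0) → x ∈ M) ∧
          ∃ (M₀ : Set ↥(Submodule.torsionBy (HeckeRing0 N 2) (J0 N) 2)) (m₀ : ↥(Submodule.torsionBy (HeckeRing0 N 2) (J0 N) 2)),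
            M₀.ncard = 8 ∧
            (∀ x ∈ M, x ∈ ((Submodule.torsionBySet (HeckeRing0 N 2) (J0 N) (modTwoHeckeIdeal D.f : Set (HeckeRing0 N 2))).comap
                (Submodule.torsionBy (HeckeRing0 N 2) (J0 N) 2).subtype).toAddSubgroup → x ∈ M₀) ∧
            (∀ x ∈ M₀, ∃ t : HeckeRing0 N 2,
              (∀ a : ↥(Submodule.torsionBy (HeckeRing0 N 2) (J0 N) 2),
                t • a ∈ ((Submodule.torsionBySet (HeckeRing0 N 2) (J0 N) (modTwoHeckeIdeal D.f : Set (HeckeRing0 N 2))).comap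
                  (Submodule.torsionBy (HeckeRing0 N 2) (J0 N) 2).subtype).toAddSubgroup) ∧ t • m₀ = x))

/-- **`KernelLetterCarrierAtLevelAtTwo L ι J`** — the kernel-letter carrier AT A COMMON LEVEL `L` (odd), conductor of neither curve (att-p3 g18's ask /
att-p4 g18's «third gap»; conjecture-grade exactly as `KernelLetterCarrierAtTwo`): there is ONE additive subgroup `M ≤ J₀(L)[2]` («the multiplicative =
connected part over `ℤ₂`») such that
* (W0′-forms) — VERBATIM as in `KernelLetterCarrierWithFormsAtTwo` (level `L`): functoriality of the connected part under EVERY lattice-compatible rational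
  form's Jacobi map `φ_g : J₀(L) → W`, `W` good ordinary at `2` [folklore: Néron mapping property + «connected ↦ connected»]
  [cite: DarmonDiamondTaylor1995, §1.5 (p. 38), §1.7 Def. 1.44 and Lemma 1.46 (p. 44–45)] [cite: ShimuraIATAF1971, Thm. 7.14];
* (W1)_L — for every `W` ON THE KILFORD STRATUM (good ordinary at `2`, no rational `2`-torsion, `Δ_W ∉ ℚ^{×2}`, `OnKilfordStratumAtTwo W`) and EVERY ideal
  `𝔪 ⊆ 𝕋_ℤ(L)` with TWO-ELEMENT quotient (`Nat.card (𝕋 ⧸ 𝔪) = 2`: maximal, `2 ∈ 𝔪`, residue field `𝔽₂`) carrying `W`'s mod-2 eigen-character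
  (`T_p − a_p(W) ∈ 𝔪` for every prime `p ∤ L`; with `L` odd this includes `p = 2`, so `𝔪` is ORDINARY — `a₂(W)` odd — and NON-EISENSTEIN — `ρ̄_𝔪^{ss} ≅ W[2]`
  by Brauer–Nesbitt, image `S₃`): IF `dim_{𝕋/𝔪} J₀(L)[𝔪] = 4` (the multiplicity-two hypothesis at `(L, 𝔪)`, a separate input) THEN `M` is `⊥`-closed inside
  `U := J₀(L)[𝔪]` for `J.pairingTwo` and there are a set `M₀ ⊇ M ∩ U` of EXACTLY `8 = 2^{2r−1}` elements and `m₀` with every `x ∈ M₀` of the form `t • m₀`,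
  `t ∈ 𝕋`, `t • J₀(L)[2] ⊆ U` — Wiese's Situation II («`p` any prime, level prime to `p`, `𝔪` ordinary, `ρ_𝔪` irreducible, `J₁`»)
  [cite: Wiese2007Multiplicities, Situation II, Thm. 2.1, Prop. 2.2, Cor. 4.2] transferred to `J₀(L)` (gap (γ)(i)) with `r = 2` as hypothesis (gap (γ)(ii))
  [cite: KilfordWiese2008, Thm. 1.3, Cor. 1.6, Question 1.9] [cite: Gross1990, p. 485, Props. 12.8–12.9].
No newform, datum or form appears in (W1)_L: the consumer `uniformize_twoOldLines_ker_iff_of_alignedAtTwo` (p699581) takes `U` abstractly and supplies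
«`θ_{Fᵢ}` kills `U^⊥ = 𝔪·J₀(L)[2]`» from att-p3 g18's `oldLines_half_smul_mem_of_mem_span` (p702281) for its generator ideal
`span{2, T_p − a_p(f) (p ∉ Q), T_q − 1 (q ∈ Q)}` (two-element quotient: every `T_n` is an integer modulo it; proper since `θ_F ≠ 0`).  CENSUS: att-p5 g19
fifth engine (`Cruxes/MainConjectureTransportAlignedAtTwo/SOCLE-att-p5-g19.md`): at 36/36 odd stratum `(N, 𝔪)` incl. 24 composite `N` — `T̄_𝔪` faithful,
`dim soc T̄_𝔪 = 3` (so `#soc = 8`), `dim J₀(N)[𝔪] = 4`, free cyclic `T̄_𝔪`-line with injective-hull quotient, `soc(T̄_𝔪)·J[2]_𝔪 = J[𝔪]` 33/33; lcm-shape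
common levels NOT RUN (symbol index ≥ 48 384) — the untested cell of this row.  Cheapest falsifier: an odd level `L` and an `𝔪` as above with
`dim J₀(L)[𝔪] = 4` but `#(M ∩ J₀(L)[𝔪]) ≠ 8` or a non-isotropic multiplicative part.  Why it might fail: only through gap (γ), as `KernelLetterCarrierAtTwo`.
[cite: DarmonDiamondTaylor1995, §1.7 (Lemma 1.38) and §4.4 (Cor. 4.19)] -/
@[conjecture] def KernelLetterCarrierAtLevelAtTwo (L : ℕ) [NeZero L] (ι : AlgebraicClosure ℚ →+* ℂ)
    (J : ModularJacobianGaloisDataWithPairing L ι) : Prop :=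
  ¬ 2 ∣ L ∧ ∃ M : AddSubgroup ↥(Submodule.torsionBy (HeckeRing0 L 2) (J0 L) 2),
    -- (W0′-forms) functoriality of the connected part under every lattice-compatible RATIONAL form's Jacobi map `J₀(L) → W`
    (∀ (W : WeierstrassCurve ℚ) [W.IsElliptic] [W.IsGloballyMinimal] (hord : IsOrdinaryAt W 2)
        (N₁ : ℕ) [NeZero N₁] (D : ModularParametrizationData W N₁) (g : CuspForm (CongruenceSubgroup.Gamma0 L) 2)
        (_ : ∀ n : ℕ, ∃ q : ℚ, cuspCoeff g n = (q : ℂ))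
        (hg : ∀ φ ∈ periodHomology L, (D.c : ℂ) * φ g ∈ D.L.lattice)
        (v : HeightOneSpectrum (𝓞 ℚ)) (hpv : ((2 : ℕ) : 𝓞 ℚ) ∈ v.asIdeal),
        ∀ m ∈ M, ∀ P : ↥(W.geomTorsion 2), W.geomPointsToComplex ι (P : geomPoints W) = D.jacobiMapForm L g hg (m : J0 L) →
          (AddSubgroup.inclusion (geomTorsion_le_geomPrimaryTorsion W 2) P : ↥(W.geomPrimaryTorsion 2)) ∈
            (reductionDatum W 2 hpv (fun h ↦ W.not_hasGoodReductionAtPrime_of_dvd_minimalDiscriminantInt 2 h hord.1)).plus) ∧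
    -- (W1)_L the multiplicative part inside `U = J₀(L)[𝔪]` for EVERY mod-2 eigen-ideal `𝔪` of a Kilford-stratum curve: `⊥`-closed, socle set of `8`
    (∀ (W : WeierstrassCurve ℚ) [W.IsElliptic] [W.IsGloballyMinimal], IsOrdinaryAt W 2 →
        (∀ x : ℚ, ¬ HasRationalTwoTorsionX W x) → ¬ IsSquare W.Δ → OnKilfordStratumAtTwo W →
        ∀ (𝔪 : Ideal (HeckeRing0 L 2)), Nat.card (HeckeRing0 L 2 ⧸ 𝔪) = 2 →
          (∀ (p : ℕ) (hp : p.Prime), ¬ p ∣ L → HeckeRing0.T L 2 p hp - ((W.frobeniusTrace p : ℤ) : HeckeRing0 L 2) ∈ 𝔪) →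
          Module.finrank (HeckeRing0 L 2 ⧸ 𝔪)
            (Submodule.torsionBySet (HeckeRing0 L 2) (J0 L) 𝔪) = 4 →
          (∀ x ∈ ((Submodule.torsionBySet (HeckeRing0 L 2) (J0 L) (𝔪 : Set (HeckeRing0 L 2))).comap
              (Submodule.torsionBy (HeckeRing0 L 2) (J0 L) 2).subtype).toAddSubgroup, (∀ m ∈ M, J.pairingTwo m x = 0) → x ∈ M) ∧
          ∃ (M₀ : Set ↥(Submodule.torsionBy (HeckeRing0 L 2) (J0 L) 2)) (m₀ : ↥(Submodule.torsionBy (HeckeRing0 L 2) (J0 L) 2)),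
            M₀.ncard = 8 ∧
            (∀ x ∈ M, x ∈ ((Submodule.torsionBySet (HeckeRing0 L 2) (J0 L) (𝔪 : Set (HeckeRing0 L 2))).comap
                (Submodule.torsionBy (HeckeRing0 L 2) (J0 L) 2).subtype).toAddSubgroup → x ∈ M₀) ∧
            (∀ x ∈ M₀, ∃ t : HeckeRing0 L 2,
              (∀ a : ↥(Submodule.torsionBy (HeckeRing0 L 2) (J0 L) 2),
                t • a ∈ ((Submodule.torsionBySet (HeckeRing0 L 2) (J0 L) (𝔪 : Set (HeckeRing0 L 2))).comap
                  (Submodule.torsionBy (HeckeRing0 L 2) (J0 L) 2).subtype).toAddSubgroup) ∧ t • m₀ = x))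

end Summit.BirchSwinnertonDyer.Rank1Residual.F1Sign2

end
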